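import Mathlib.RingTheory.LocalRing.MaximalIdeal.Basic
import Mathlib.RingTheory.KrullDimension.Basic
import Mathlib.Algebra.CharP.Lemmas
import Mathlib.RingTheory.Coprime.Lemmas
import HarnessLib

/-!
# Stub `stub_pointwiseTransfer` for crux stmt-ResolutionOfSingularities-15917 (`RadicialJung.CleanModels`)

Pointwise transfer from loose to exact normal forms. In a local ring `O` of prime characteristic
`p` with an `O`-algebra `K`, an element `x ∈ K` which is loosely clean — `x = u ∏ t_i^{a_i}`
(`u` a unit, `(t_i)` spanning `𝔪`, `m ≥ 1`, `p ∤ a_i`), or `x = u` a unit with `u - c^p ∉ 𝔪`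
for all `c`, or `x = s` with `s - c^p ∈ 𝔪 ∖ 𝔪²` — becomes exactly clean after the admissible
change `x ↦ ε^p x + δ` with `ε` a unit of `O` and `δ ∈ {0, 1}`.

Proof. Toroidal case: Bézout `α a₀ + β p = 1` for the exponent `a₀ = a 0` (coprime to the prime
`p`), so `u = (u^α)^{a₀} (u^β)^p` in the unit group; rescale `t₀ ↦ u^α t₀` (same span) and take
`ε = u^{-β}`, `δ = 0`. Residually new unit: `ε = 1`, `δ = 0`. Type `s - c^p ∈ 𝔪 ∖ 𝔪²`:
`ε = 1`; `δ = 0` if `s` is a unit, else `δ = 1`: then `s + 1` is a unit and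
`(s + 1) - (c + 1)^p = s - c^p` by the freshman's dream.
-/

set_option linter.dupNamespace false

namespace Summit.ResolutionOfSingularities.ResolutionOfSingularities.Theorems.RadicialJung.CleanModels

/-- Rescaling one member of a family by a unit does not change the ideal the family spans. -/
theorem span_range_ite_mul_eq {R ι : Type*} [CommSemiring R] [DecidableEq ι] (t : ι → R)
    (j₀ : ι) {w : R} (hw : IsUnit w) :
    Ideal.span (Set.range fun j => (if j = j₀ then w else 1) * t j) = Ideal.span (Set.range t) := by
  have hc : ∀ j, IsUnit (if j = j₀ then w else 1) := fun j => by
    split_ifs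
    exacts [hw, isUnit_one]
  apply le_antisymm
  · refine Ideal.span_le.2 ?_
    rintro _ ⟨j, rfl⟩
    exact Ideal.mul_mem_left _ _ (Ideal.subset_span ⟨j, rfl⟩)
  · refine Ideal.span_le.2 ?_
    rintro _ ⟨j, rfl⟩
    have h : (fun j => (if j = j₀ then w else 1) * t j) j ∈
        Ideal.span (Set.range fun j => (if j = j₀ then w else 1) * t j) :=
      Ideal.subset_span ⟨j, rfl⟩
    exact (Ideal.unit_mul_mem_iff_mem _ (hc j)).1 h

/-- Absorbing a factor `w ^ (a i₀)` into the `i₀`-th member of a product of powers of an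
injectively indexed subfamily. -/
theorem pow_mul_prod_pow_eq_prod_ite {R ι κ : Type*} [CommMonoid R] [Fintype ι] [DecidableEq κ]
    (t : κ → R) {f : ι → κ} (hf : Function.Injective f) (a : ι → ℕ) (i₀ : ι) (w : R) :
    w ^ (a i₀) * ∏ i, t (f i) ^ (a i) = ∏ i, ((if f i = f i₀ then w else 1) * t (f i)) ^ (a i) := by
  classical
  have h1 : ∀ i, ((if f i = f i₀ then w else 1) * t (f i)) ^ (a i) =
      (if i = i₀ then w ^ (a i) else 1) * t (f i) ^ (a i) := fun i => by
    by_cases h : i = i₀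
    · subst h
      rw [if_pos rfl, if_pos rfl, mul_pow]
    · rw [if_neg (hf.ne h), if_neg h, mul_pow, one_pow]
  simp_rw [h1, Finset.prod_mul_distrib, Finset.prod_ite_eq', Finset.mem_univ, if_true]

/-- Bézout in a group: if `α a + β p = 1` then `(U^α)^a (U^β)^p = U`. -/
theorem zpow_pow_mul_zpow_pow_eq_self {M : Type*} [Group M] (U : M) {a p : ℕ} {α β : ℤ}
    (h : α * a + β * p = 1) : (U ^ α) ^ a * (U ^ β) ^ p = U := by
  rw [← zpow_natCast (U ^ α), ← zpow_natCast (U ^ β), ← zpow_mul, ← zpow_mul, ← zpow_add, h,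
    zpow_one]

/-- Unit absorption: for a unit `u` and an exponent `a` prime to the prime characteristic-type
number `p`, `u = w ^ a * e ^ p` with `w` a unit and `e` a unit with explicit inverse `ε`. -/
theorem exists_unit_eq_pow_mul_pow {R : Type*} [CommRing R] {u : R} (hu : IsUnit u) {a p : ℕ}
    (hp : p.Prime) (ha : ¬ p ∣ a) :
    ∃ w e ε : R, IsUnit w ∧ IsUnit ε ∧ ε * e = 1 ∧ u = w ^ a * e ^ p := by
  obtain ⟨α, β, hαβ⟩ : IsCoprime (a : ℤ) (p : ℤ) :=
    Nat.isCoprime_iff_coprime.2 ((Nat.Prime.coprime_iff_not_dvd hp).2 ha).symm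
  refine ⟨((hu.unit ^ α : Rˣ) : R), ((hu.unit ^ β : Rˣ) : R), ((hu.unit ^ β)⁻¹ : Rˣ),
    (hu.unit ^ α).isUnit, (hu.unit ^ β)⁻¹.isUnit, Units.inv_mul _, ?_⟩
  rw [← Units.val_pow_eq_pow_val, ← Units.val_pow_eq_pow_val, ← Units.val_mul,
    zpow_pow_mul_zpow_pow_eq_self hu.unit hαβ, hu.unit_spec]

/-- In characteristic `p`, the shift by one commutes with `p`-th power defects:
`(s + 1) - (c + 1)^p = s - c^p`. -/
theorem add_one_sub_add_one_pow_char {R : Type*} [CommRing R] (p : ℕ) [Fact p.Prime]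
    [CharP R p] (s c : R) : (s + 1) - (c + 1) ^ p = s - c ^ p := by
  rw [add_pow_char, one_pow]
  ring

/-- In a local ring, a non-unit shifted by one is a unit. -/
theorem isUnit_add_one_of_not_isUnit {R : Type*} [CommRing R] [IsLocalRing R] {s : R}
    (hs : ¬ IsUnit s) : IsUnit (s + 1) := by
  have h : IsUnit (1 - -s) :=
    IsLocalRing.isUnit_one_sub_self_of_mem_nonunits (-s)
      (mem_nonunits_iff.2 (by rwa [IsUnit.neg_iff]))
  rwa [sub_neg_eq_add, add_comm] at h

/-- **Pointwise transfer from loose to exact normal forms.** In a local ring `O` of prime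
characteristic `p` with an `O`-algebra `K`, let `x ∈ K` be loosely clean: `x = u ∏ t_i^{a_i}`
(`(t_i)` a generating system of `𝔪` of length `dim O`, `u` a unit, `m ≥ 1`, `p ∤ a_i`), or
`x = u` a unit with `∀ c, u - c^p ∉ 𝔪`, or `x = s` with `s - c^p ∈ 𝔪 ∖ 𝔪²`. Then for some unit
`ε` and some `δ ∈ {0, 1}` the element `ε^p x + δ` is exactly clean: unit absorption
(`1 = α a₀ + β p`, `u = (u^α)^{a₀} (u^β)^p`, `t₀ ↦ u^α t₀`, `ε = u^{-β}`), resp. `ε = 1, δ = 0`,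
resp. `ε = 1` and `δ = 1` exactly when `s` is not a unit (then `s + 1` is a unit and
`(s + 1) - (c + 1)^p = s - c^p`). -/
theorem stub_pointwiseTransfer {O K : Type*} [CommRing O] [IsLocalRing O] [CommRing K]
    [Algebra O K] (p : ℕ) (hp : p.Prime) [CharP O p] (x : K)
    (hx : (∃ (d m : ℕ) (hmd : m ≤ d) (t : Fin d → O) (a : Fin m → ℕ) (u : O), IsUnit u ∧
          Ideal.span (Set.range t) = IsLocalRing.maximalIdeal O ∧
          ringKrullDim O = (d : WithBot ℕ∞) ∧ 0 < m ∧ (∀ i, ¬ p ∣ a i) ∧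
          x = algebraMap O K (u * ∏ i : Fin m, t (Fin.castLE hmd i) ^ (a i))) ∨
        (∃ u : O, IsUnit u ∧ x = algebraMap O K u ∧
          ∀ c : O, u - c ^ p ∉ IsLocalRing.maximalIdeal O) ∨
        (∃ s c : O, x = algebraMap O K s ∧ s - c ^ p ∈ IsLocalRing.maximalIdeal O ∧
          s - c ^ p ∉ IsLocalRing.maximalIdeal O ^ 2)) :
    ∃ (ε : O) (δ : ℕ), IsUnit ε ∧ δ ≤ 1 ∧
      ((∃ (d m : ℕ) (hmd : m ≤ d) (t : Fin d → O) (a : Fin m → ℕ),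
          Ideal.span (Set.range t) = IsLocalRing.maximalIdeal O ∧
          ringKrullDim O = (d : WithBot ℕ∞) ∧ 0 < m ∧ (∀ i, ¬ p ∣ a i) ∧
          algebraMap O K ε ^ p * x + δ =
            ∏ i : Fin m, (algebraMap O K (t (Fin.castLE hmd i))) ^ (a i)) ∨
        (∃ u₀ : O, IsUnit u₀ ∧ algebraMap O K ε ^ p * x + δ = algebraMap O K u₀ ∧
          ((∀ c : O, u₀ - c ^ p ∉ IsLocalRing.maximalIdeal O) ∨
            (∃ c : O, u₀ - c ^ p ∈ IsLocalRing.maximalIdeal O ∧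
              u₀ - c ^ p ∉ IsLocalRing.maximalIdeal O ^ 2)))) := by
  haveI : Fact p.Prime := ⟨hp⟩
  rcases hx with ⟨d, m, hmd, t, a, u, hu, hspan, hdim, hm, ha, hxu⟩ | ⟨u, hu, hxu, hc⟩ |
    ⟨s, c, hxs, hsc, hsc2⟩
  · -- toroidal type: unit absorption
    set i₀ : Fin m := ⟨0, hm⟩ with hi₀
    obtain ⟨w, e, ε, hw, hε, hεe, hue⟩ := exists_unit_eq_pow_mul_pow hu hp (ha i₀)
    have hεu : ε ^ p * u = w ^ (a i₀) := by
      rw [hue, mul_left_comm, ← mul_pow, hεe, one_pow, mul_one]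
    obtain ⟨t', ht'span, ht'prod⟩ : ∃ t' : Fin d → O,
        Ideal.span (Set.range t') = IsLocalRing.maximalIdeal O ∧
          w ^ (a i₀) * ∏ i : Fin m, t (Fin.castLE hmd i) ^ (a i) =
            ∏ i : Fin m, t' (Fin.castLE hmd i) ^ (a i) :=
      ⟨fun j => (if j = Fin.castLE hmd i₀ then w else 1) * t j,
        by rw [span_range_ite_mul_eq t _ hw, hspan],
        pow_mul_prod_pow_eq_prod_ite t (Fin.castLE_injective hmd) a i₀ w⟩
    refine ⟨ε, 0, hε, zero_le_one, Or.inl ⟨d, m, hmd, t', a, ht'span, hdim, hm, ha, ?_⟩⟩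
    rw [Nat.cast_zero, add_zero, hxu, ← map_pow, ← map_mul, ← mul_assoc, hεu, ht'prod, map_prod]
    simp only [map_pow]
  · -- residually new unit: nothing to do
    refine ⟨1, 0, isUnit_one, zero_le_one, Or.inr ⟨u, hu, ?_, Or.inl hc⟩⟩
    rw [Nat.cast_zero, add_zero, map_one, one_pow, one_mul, hxu]
  · -- `s - c^p ∈ 𝔪 ∖ 𝔪²`: shift by one if `s` is not a unit
    by_cases hs : IsUnit s
    · refine ⟨1, 0, isUnit_one, zero_le_one, Or.inr ⟨s, hs, ?_, Or.inr ⟨c, hsc, hsc2⟩⟩⟩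
      rw [Nat.cast_zero, add_zero, map_one, one_pow, one_mul, hxs]
    · refine ⟨1, 1, isUnit_one, le_rfl, Or.inr ⟨s + 1, isUnit_add_one_of_not_isUnit hs, ?_,
        Or.inr ⟨c + 1, ?_, ?_⟩⟩⟩
      · rw [Nat.cast_one, map_one, one_pow, one_mul, hxs, map_add, map_one]
      · rw [add_one_sub_add_one_pow_char p s c]
        exact hsc
      · rw [add_one_sub_add_one_pow_char p s c]
        exact hsc2

end Summit.ResolutionOfSingularities.ResolutionOfSingularities.Theorems.RadicialJung.CleanModels
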